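import Mathlib
import HarnessLib
import Literature.Analysis.Convex.KrasnoselskijIteration
import Literature.Analysis.Convex.BaillonHaddad
import Literature.Analysis.Convex.AveragedOperators
import Literature.Analysis.Convex.FixedPointResidualRates

/-!
# Strictly pseudocontractive operators and the Krasnoselskij iteration (Browder–Petryshyn)

Source: V. Berinde, *Iterative Approximation of Fixed Points*, 2nd ed., Lecture Notes in
Mathematics 1912, Springer (2007) [Berinde2007]: Chapter 1 §1.1, Definition 1.13 and the Remarks
3)–4) after Definition 1.14 (pseudocontractions and strict pseudocontractions in a Hilbert space);
Chapter 3 §3.2 "Strictly pseudocontractive operators", Theorem 3.5 with its proof (by §3.5 this is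
Theorem 12 of Browder and Petryshyn, J. Math. Anal. Appl. 20 (1967)); Chapter 4, Exercises 4.6, 4.7
(nonexpansive ⟹ pseudocontractive, not conversely) and 4.8 (Osilike–Udomene: a strict
pseudocontraction is Lipschitzian).

Let `H` be a real inner product space, `U = I - T`.

* Remark 3): `T` is a *pseudocontraction* if `‖Tx - Ty‖² ≤ ‖x - y‖² + ‖(I - T)x - (I - T)y‖²`,
  equivalently `⟨Tx - Ty, x - y⟩ ≤ ‖x - y‖²`, equivalently `⟨(I - T)x - (I - T)y, x - y⟩ ≥ 0`
  (`IsPseudocontractive`, `isPseudocontractive_iff_inner`, `isPseudocontractive_iff_inner_nonneg`).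
* Remark 4) / (7) of §3.2: `T` is *strictly pseudocontractive* with constant `k < 1` if
  `‖Tx - Ty‖² ≤ ‖x - y‖² + k‖(I - T)x - (I - T)y‖²` (`IsStrictPseudocontractive k T`).
  The first step of the proof of Theorem 3.5: this says exactly that `U = I - T` satisfies
  `⟨Ux - Uy, x - y⟩ ≥ m‖Ux - Uy‖²` with `m = (1 - k)/2` (`isStrictPseudocontractive_iff_inner`;
  in the vocabulary of this library: `U` is `(1 - k)/2`-cocoercive,
  `isStrictPseudocontractive_iff_isCocoercive`, and — dividing `T_{1-k} = (I - (1 - k)U)` back —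
  `T` is `1/(1 - k)`-averaged in the extended sense of `AveragedOperators.IsAveraged`,
  `isStrictPseudocontractive_iff_isAveraged`).
* The second step: for `0 ≤ t ≤ 1 - k = 2m` the averaged map `T_t = (1 - t)I + tT = I - tU`
  satisfies `‖T_t x - T_t y‖² ≤ ‖x - y‖² + (t² - 2tm)‖Ux - Uy‖² ≤ ‖x - y‖²`, i.e. `T_t` is
  nonexpansive (`norm_averagedMap_sub_sq_le_sps`, `norm_averagedMap_sub_le_sps`); moreover `T_t` is
  `t/(1 - k)`-averaged (`isAveraged_averagedMap_sps`).  The third step: `(T_t)_λ = T_{λt}`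
  (`FixedPointResidualRates.averagedMap_averagedMap`, used by name), so the Krasnoselskij
  iteration of `T` with parameter `μ = λt < 1 - k` is the Krasnoselskij iteration of the
  nonexpansive `T_{1-k}` with parameter `λ = μ/(1 - k) ∈ (0, 1)` (`kmIter_eq_kmIter_averagedMap`).
* **Theorem 3.5** (Browder–Petryshyn), in the framing of this library's Theorem 3.2 anchor
  (`KrasnoselskijIteration`): for a `k`-strict pseudocontraction `T` (`k < 1`) with a fixed point
  `p` and `0 < μ < 1 - k`, the Krasnoselskij iteration `x_{n+1} = (1 - μ)x_n + μTx_n` is Fejér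
  monotone to `p` (`norm_kmIter_succ_sub_le_sps`), asymptotically regular `‖x_n - Tx_n‖ → 0`
  (`tendsto_norm_kmIter_sub_apply_sps`), converges to a fixed point as soon as a subsequence
  converges ("demicompact" case, `tendsto_kmIter_of_subseq_tendsto_sps`), and in a
  finite-dimensional (proper) space converges to a fixed point of `T` for every `x₀`
  (`exists_tendsto_kmIter_sps`).
* Exercise 4.6: a nonexpansive map is a pseudocontraction (indeed a `0`-strict one,
  `isStrictPseudocontractive_zero_iff`); Exercise 4.7: `Tx = 1 - x^{2/3}` on `[0, 1]` is a
  continuous pseudocontraction which is not nonexpansive (`ex47_inner_le`, `ex47_not_nonexpansive`);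
  Exercise 4.8: a `k`-strict pseudocontraction (`0 ≤ k < 1`) is Lipschitzian, with constant
  `(1 + k)/(1 - k)` (`IsStrictPseudocontractive.lipschitz`).

Deviations from the source (declared).  (a) As in the Theorem 3.2 anchor, `T` is defined on all
of `H` and the existence of a fixed point is a hypothesis; [Ber07] takes `T : C → C` on a bounded
closed convex `C` and gets existence from Browder–Petryshyn.  (b) The weak-convergence assertion
of Theorem 3.5 in infinite dimension is not formalised; the strong conclusions (demicompact case,
finite dimension) are.  (c) `k` is any real number in the definition; `k < 1` (resp. `0 ≤ k`) is
assumed where used.  (d) Exercise 4.8 does not name the constant; `(1 + k)/(1 - k)` is what the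
proof gives.  By-name reuse: `averagedMap`, `kmIter` and the Theorem 3.2 conclusions
(`KrasnoselskijIteration`), `IsCocoercive` (`BaillonHaddad`), `IsAveraged`,
`isAveraged_iff_norm_sq`, `isAveraged_forwardStep_of_isCocoercive` (`AveragedOperators`),
`averagedMap_averagedMap`, `kmIter_averagedMap` (`FixedPointResidualRates`).
-/

open Filter Topology Set Function
open scoped RealInnerProductSpace
open Literature.Analysis.Convex.KrasnoselskijIteration
open Literature.Analysis.Convex.BaillonHaddad (IsCocoercive)
open Literature.Analysis.Convex.AveragedOperators (IsAveraged isAveraged_iff_norm_sq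
  isAveraged_forwardStep_of_isCocoercive)
open Literature.Analysis.Convex.FixedPointResidualRates (averagedMap_averagedMap
  kmIter_averagedMap)

namespace Literature.Analysis.Convex.StrictPseudocontractions

variable {E : Type*} [NormedAddCommGroup E] [InnerProductSpace ℝ E]

/-! ## Pseudocontractions and strict pseudocontractions in a Hilbert space -/

/-- Remark 3): `T` is a *pseudocontraction* if `‖Tx - Ty‖² ≤ ‖x - y‖² + ‖(I - T)x - (I - T)y‖²`.
[cite: Berinde2007, Ch. 1 §1.1 Remark 3 after Def. 1.14] -/
def IsPseudocontractive (T : E → E) : Prop :=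
  ∀ x y, ‖T x - T y‖ ^ 2 ≤ ‖x - y‖ ^ 2 + ‖(x - T x) - (y - T y)‖ ^ 2

/-- Remark 4) / (7): `T` is *strictly pseudocontractive* with constant `k` if
`‖Tx - Ty‖² ≤ ‖x - y‖² + k‖(I - T)x - (I - T)y‖²`.
[cite: Berinde2007, Ch. 1 §1.1 Remark 4 after Def. 1.14; Ch. 3 §3.2 Thm. 3.5 (7)] -/
def IsStrictPseudocontractive (k : ℝ) (T : E → E) : Prop :=
  ∀ x y, ‖T x - T y‖ ^ 2 ≤ ‖x - y‖ ^ 2 + k * ‖(x - T x) - (y - T y)‖ ^ 2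

section Basic

variable {T : E → E} {k k' : ℝ}

/-- `‖Tx - Ty‖² = ‖x - y‖² - 2⟨x - y, Ux - Uy⟩ + ‖Ux - Uy‖²` for `U = I - T` (the expansion used
in the proof of Theorem 3.5). [cite: Berinde2007, Ch. 3 §3.2 Thm. 3.5 (proof)] -/
theorem norm_apply_sub_sq (T : E → E) (x y : E) :
    ‖T x - T y‖ ^ 2 =
      ‖x - y‖ ^ 2 - 2 * ⟪x - y, (x - T x) - (y - T y)⟫ + ‖(x - T x) - (y - T y)‖ ^ 2 := by
  have e : T x - T y = (x - y) - ((x - T x) - (y - T y)) := by abel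
  rw [e, norm_sub_sq_real]

/-- Remark 3): pseudocontractive ⟺ `⟨Tx - Ty, x - y⟩ ≤ ‖x - y‖²`.
[cite: Berinde2007, Ch. 1 §1.1 Remark 3 after Def. 1.14] -/
theorem isPseudocontractive_iff_inner :
    IsPseudocontractive T ↔ ∀ x y, ⟪T x - T y, x - y⟫ ≤ ‖x - y‖ ^ 2 := by
  refine forall₂_congr fun x y => ?_
  have e : ⟪T x - T y, x - y⟫ = ‖x - y‖ ^ 2 - ⟪x - y, (x - T x) - (y - T y)⟫ := by
    have h : T x - T y = (x - y) - ((x - T x) - (y - T y)) := by abel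
    rw [h, inner_sub_left, real_inner_self_eq_norm_sq, real_inner_comm]
  rw [norm_apply_sub_sq, e]
  constructor <;> intro h <;> linarith

/-- Remark 3): pseudocontractive ⟺ `⟨(I - T)x - (I - T)y, x - y⟩ ≥ 0` (`I - T` is monotone).
[cite: Berinde2007, Ch. 1 §1.1 Remark 3 after Def. 1.14 and Remark 1 after Def. 1.14] -/
theorem isPseudocontractive_iff_inner_nonneg :
    IsPseudocontractive T ↔ ∀ x y, 0 ≤ ⟪(x - T x) - (y - T y), x - y⟫ := by
  refine forall₂_congr fun x y => ?_
  rw [norm_apply_sub_sq, real_inner_comm]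
  constructor <;> intro h <;> linarith

/-- First step of the proof of Theorem 3.5: (7) says that `U = I - T` satisfies
`⟨Ux - Uy, x - y⟩ ≥ m‖Ux - Uy‖²` with `m = (1 - k)/2` ("strongly monotone" in [Ber07]).
[cite: Berinde2007, Ch. 3 §3.2 Thm. 3.5 (proof)] -/
theorem isStrictPseudocontractive_iff_inner :
    IsStrictPseudocontractive k T ↔
      ∀ x y, (1 - k) / 2 * ‖(x - T x) - (y - T y)‖ ^ 2 ≤ ⟪x - y, (x - T x) - (y - T y)⟫ := by
  refine forall₂_congr fun x y => ?_
  rw [norm_apply_sub_sq]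
  constructor <;> intro h <;> linarith

/-- Dictionary: `T` is `k`-strictly pseudocontractive iff `I - T` is `(1 - k)/2`-cocoercive
(`Literature.Analysis.Convex.BaillonHaddad.IsCocoercive`).
[cite: Berinde2007, Ch. 3 §3.2 Thm. 3.5 (proof)] -/
theorem isStrictPseudocontractive_iff_isCocoercive :
    IsStrictPseudocontractive k T ↔ IsCocoercive ((1 - k) / 2) (fun x => x - T x) :=
  isStrictPseudocontractive_iff_inner

/-- Dictionary: for `k < 1`, `T` is `k`-strictly pseudocontractive iff `T` is `1/(1 - k)`-averaged
in the extended sense of `Literature.Analysis.Convex.AveragedOperators.IsAveraged` (the constant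
exceeds `1` when `k > 0`): `T = (1 - 1/(1-k)) I + (1/(1-k)) T_{1-k}` with `T_{1-k}` nonexpansive.
[cite: Berinde2007, Ch. 3 §3.2 Thm. 3.5 (proof); CombettesYamada2015, Prop 2.1 (i)⇔(iii)] -/
theorem isStrictPseudocontractive_iff_isAveraged (hk : k < 1) :
    IsStrictPseudocontractive k T ↔ IsAveraged (1 / (1 - k)) T := by
  have h1k : 0 < 1 - k := sub_pos.2 hk
  have hα : 0 < 1 / (1 - k) := by positivity
  rw [isAveraged_iff_norm_sq hα]
  refine forall₂_congr fun x y => ?_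
  have hαk : 1 / (1 - k) * (1 - k) = 1 := by field_simp
  constructor
  · intro h
    have h' := mul_le_mul_of_nonneg_left h hα.le
    nlinarith [h', hαk, sq_nonneg ‖(x - T x) - (y - T y)‖, sq_nonneg ‖T x - T y‖,
      sq_nonneg ‖x - y‖]
  · intro h
    have h' := mul_le_mul_of_nonneg_left h h1k.le
    nlinarith [h', hαk, sq_nonneg ‖(x - T x) - (y - T y)‖, sq_nonneg ‖T x - T y‖,
      sq_nonneg ‖x - y‖]

omit [InnerProductSpace ℝ E] in
/-- Monotonicity in the constant. [cite: Berinde2007, Ch. 1 §1.1 Remark 4 after Def. 1.14] -/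
theorem IsStrictPseudocontractive.mono (h : IsStrictPseudocontractive k T) (hk : k ≤ k') :
    IsStrictPseudocontractive k' T := fun x y =>
  (h x y).trans (by nlinarith [mul_le_mul_of_nonneg_right hk (sq_nonneg ‖(x - T x) - (y - T y)‖)])

omit [InnerProductSpace ℝ E] in
/-- A strict pseudocontraction (`k ≤ 1`) is a pseudocontraction.
[cite: Berinde2007, Ch. 1 §1.1 Remarks 3–4 after Def. 1.14] -/
theorem IsStrictPseudocontractive.isPseudocontractive (h : IsStrictPseudocontractive k T)
    (hk : k ≤ 1) : IsPseudocontractive T := fun x y => by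
  have h1 := h.mono hk x y
  rwa [one_mul] at h1

omit [InnerProductSpace ℝ E] in
/-- `0`-strictly pseudocontractive = nonexpansive.
[cite: Berinde2007, Ch. 1 §1.1 Remark 4 after Def. 1.14; Ch. 4 Exercise 4.6] -/
theorem isStrictPseudocontractive_zero_iff :
    IsStrictPseudocontractive 0 T ↔ ∀ x y, ‖T x - T y‖ ≤ ‖x - y‖ := by
  refine forall₂_congr fun x y => ?_
  rw [zero_mul, add_zero, pow_le_pow_iff_left₀ (norm_nonneg _) (norm_nonneg _) two_ne_zero]

omit [InnerProductSpace ℝ E] in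
/-- Exercise 4.6: a nonexpansive map is a pseudocontraction.
[cite: Berinde2007, Ch. 4 Exercise 4.6] -/
theorem isPseudocontractive_of_nonexpansive (hT : ∀ x y, ‖T x - T y‖ ≤ ‖x - y‖) :
    IsPseudocontractive T :=
  (isStrictPseudocontractive_zero_iff.2 hT).isPseudocontractive zero_le_one

end Basic

/-! ## The averaged map `T_t = (1 - t)I + tT = I - tU` of a strict pseudocontraction -/

section AveragedMap

variable {T : E → E} {k t : ℝ}

/-- `T_t = I - tU` with `U = I - T`. [cite: Berinde2007, Ch. 3 §3.2 Thm. 3.5 (proof)] -/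
theorem averagedMap_eq_sub_smul (T : E → E) (t : ℝ) (x : E) :
    averagedMap T t x = x - t • (x - T x) := by
  simp only [averagedMap, smul_sub, sub_smul, one_smul]
  abel

/-- `‖x - T_t x‖ = |t| · ‖x - Tx‖`. [cite: Berinde2007, Ch. 3 §3.2 Thm. 3.5 (proof)] -/
theorem norm_sub_averagedMap (T : E → E) (t : ℝ) (x : E) :
    ‖x - averagedMap T t x‖ = |t| * ‖x - T x‖ := by
  rw [averagedMap_eq_sub_smul, sub_sub_cancel, norm_smul, Real.norm_eq_abs]

/-- Second step of the proof of Theorem 3.5: for `t ≥ 0`,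
`‖T_t x - T_t y‖² ≤ ‖x - y‖² + (t² - 2tm)‖Ux - Uy‖²`, `2m = 1 - k`.
[cite: Berinde2007, Ch. 3 §3.2 Thm. 3.5 (proof)] -/
theorem norm_averagedMap_sub_sq_le_sps (h : IsStrictPseudocontractive k T) (ht : 0 ≤ t)
    (x y : E) :
    ‖averagedMap T t x - averagedMap T t y‖ ^ 2 ≤
      ‖x - y‖ ^ 2 + (t ^ 2 - t * (1 - k)) * ‖(x - T x) - (y - T y)‖ ^ 2 := by
  have e : averagedMap T t x - averagedMap T t y = (x - y) - t • ((x - T x) - (y - T y)) := by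
    rw [averagedMap_eq_sub_smul, averagedMap_eq_sub_smul]
    module
  rw [e, norm_sub_sq_real, real_inner_smul_right, norm_smul, Real.norm_eq_abs, mul_pow, sq_abs]
  have h1 := isStrictPseudocontractive_iff_inner.1 h x y
  nlinarith [mul_le_mul_of_nonneg_left h1 ht]

/-- "… which shows that `T_t` is nonexpansive" for `0 ≤ t ≤ 2m = 1 - k`.
[cite: Berinde2007, Ch. 3 §3.2 Thm. 3.5 (proof)] -/
theorem norm_averagedMap_sub_le_sps (h : IsStrictPseudocontractive k T) (ht0 : 0 ≤ t)
    (ht : t ≤ 1 - k) (x y : E) : ‖averagedMap T t x - averagedMap T t y‖ ≤ ‖x - y‖ := by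
  rw [← pow_le_pow_iff_left₀ (norm_nonneg _) (norm_nonneg _) two_ne_zero]
  have h1 := norm_averagedMap_sub_sq_le_sps h ht0 x y
  have h2 : (t ^ 2 - t * (1 - k)) * ‖(x - T x) - (y - T y)‖ ^ 2 ≤ 0 :=
    mul_nonpos_of_nonpos_of_nonneg (by nlinarith) (sq_nonneg _)
  linarith

/-- `T_t` is `t/(1 - k)`-averaged for a `k`-strict pseudocontraction (`k < 1`): the forward step
`I - tU` of the `(1 - k)/2`-cocoercive `U = I - T`
(`AveragedOperators.isAveraged_forwardStep_of_isCocoercive`).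
[cite: Berinde2007, Ch. 3 §3.2 Thm. 3.5 (proof); CombettesYamada2015, proof of Prop 4.4] -/
theorem isAveraged_averagedMap_sps (h : IsStrictPseudocontractive k T) (hk : k < 1) (t : ℝ) :
    IsAveraged (t / (1 - k)) (averagedMap T t) := by
  have h1 := isAveraged_forwardStep_of_isCocoercive
    (isStrictPseudocontractive_iff_isCocoercive.1 h) (by linarith : 0 < (1 - k) / 2) t
  have e1 : (2 : ℝ) * ((1 - k) / 2) = 1 - k := by ring
  have e2 : (fun x => x - t • (x - T x)) = averagedMap T t :=
    funext fun x => (averagedMap_eq_sub_smul T t x).symm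
  rwa [e1, e2] at h1

/-- Third step of the proof of Theorem 3.5: `(T_t)_λ = T_{λt}`, so the Krasnoselskij iteration of
`T` with parameter `μ` is the Krasnoselskij iteration of `T_{1-k}` with parameter `μ/(1 - k)`.
[cite: Berinde2007, Ch. 3 §3.2 Thm. 3.5 (proof)] -/
theorem kmIter_eq_kmIter_averagedMap (hk : k < 1) (T : E → E) (μ : ℝ) (x₀ : E) :
    kmIter T μ x₀ = kmIter (averagedMap T (1 - k)) (μ / (1 - k)) x₀ := by
  rw [kmIter_averagedMap, div_mul_cancel₀ μ (sub_pos.2 hk).ne']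

end AveragedMap

/-! ## Theorem 3.5 (Browder–Petryshyn) -/

section Theorem35

variable {T : E → E} {k μ : ℝ} {x₀ p q : E}

/-- Theorem 3.5, Fejér monotonicity of the Krasnoselskij iteration of a `k`-strict
pseudocontraction with a fixed point `p`, for `0 < μ < 1 - k`: `‖x_{n+1} - p‖ ≤ ‖x_n - p‖`.
[cite: Berinde2007, Ch. 3 §3.2 Thm. 3.5 (proof, via Thm. 3.2/3.4)] -/
theorem norm_kmIter_succ_sub_le_sps (h : IsStrictPseudocontractive k T) (hk : k < 1)
    (hp : T p = p) (hμ0 : 0 < μ) (hμ : μ < 1 - k) (n : ℕ) :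
    ‖kmIter T μ x₀ (n + 1) - p‖ ≤ ‖kmIter T μ x₀ n - p‖ := by
  have h1k : 0 < 1 - k := sub_pos.2 hk
  rw [kmIter_eq_kmIter_averagedMap hk]
  exact norm_kmIter_succ_sub_le (norm_averagedMap_sub_le_sps h h1k.le le_rfl)
    (averagedMap_eq_self_of_eq hp) (div_pos hμ0 h1k).le ((div_lt_one h1k).2 hμ).le n

/-- Theorem 3.5, asymptotic regularity: `‖x_n - Tx_n‖ → 0` for `0 < μ < 1 - k`.
[cite: Berinde2007, Ch. 3 §3.2 Thm. 3.5 (proof, via Thm. 3.2)] -/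
theorem tendsto_norm_kmIter_sub_apply_sps (h : IsStrictPseudocontractive k T) (hk : k < 1)
    (hp : T p = p) (hμ0 : 0 < μ) (hμ : μ < 1 - k) :
    Tendsto (fun n => ‖kmIter T μ x₀ n - T (kmIter T μ x₀ n)‖) atTop (𝓝 0) := by
  have h1k : 0 < 1 - k := sub_pos.2 hk
  have hS := norm_averagedMap_sub_le_sps h h1k.le le_rfl
  have hpS : averagedMap T (1 - k) p = p := averagedMap_eq_self_of_eq hp
  have hlim := tendsto_norm_kmIter_sub_apply (x₀ := x₀) hS hpS (div_pos hμ0 h1k)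
    ((div_lt_one h1k).2 hμ)
  rw [← kmIter_eq_kmIter_averagedMap hk] at hlim
  have e : ∀ n, ‖kmIter T μ x₀ n - T (kmIter T μ x₀ n)‖ =
      (1 - k)⁻¹ * ‖kmIter T μ x₀ n - averagedMap T (1 - k) (kmIter T μ x₀ n)‖ := fun n => by
    rw [norm_sub_averagedMap, abs_of_pos h1k, ← mul_assoc, inv_mul_cancel₀ h1k.ne', one_mul]
  simp_rw [e]
  have h2 := hlim.const_mul (1 - k)⁻¹
  rwa [mul_zero] at h2

/-- Theorem 3.5, the "demicompact" conclusion: if some subsequence of the Krasnoselskij iteration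
(`0 < μ < 1 - k`) converges to `q`, then `Tq = q` and the whole sequence converges to `q`.
[cite: Berinde2007, Ch. 3 §3.2 Thm. 3.5 (second part)] -/
theorem tendsto_kmIter_of_subseq_tendsto_sps (h : IsStrictPseudocontractive k T) (hk : k < 1)
    (hp : T p = p) (hμ0 : 0 < μ) (hμ : μ < 1 - k) {φ : ℕ → ℕ} (hφ : StrictMono φ)
    (hlim : Tendsto (fun j => kmIter T μ x₀ (φ j)) atTop (𝓝 q)) :
    T q = q ∧ Tendsto (kmIter T μ x₀) atTop (𝓝 q) := by
  have h1k : 0 < 1 - k := sub_pos.2 hk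
  have hS := norm_averagedMap_sub_le_sps h h1k.le le_rfl
  have hpS : averagedMap T (1 - k) p = p := averagedMap_eq_self_of_eq hp
  rw [kmIter_eq_kmIter_averagedMap hk] at hlim ⊢
  obtain ⟨hq, hconv⟩ := tendsto_kmIter_of_subseq_tendsto hS hpS (div_pos hμ0 h1k)
    ((div_lt_one h1k).2 hμ) hφ hlim
  exact ⟨(averagedMap_eq_self_iff h1k.ne').1 hq, hconv⟩

/-- **Theorem 3.5** (Browder–Petryshyn 1967), finite-dimensional / proper-space form: if `T` is
`k`-strictly pseudocontractive (`k < 1`) on a proper real inner product space and has a fixed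
point, then for every `0 < μ < 1 - k` and every `x₀` the Krasnoselskij iteration
`x_{n+1} = (1 - μ)x_n + μTx_n` converges to a fixed point of `T`.
[cite: Berinde2007, Ch. 3 §3.2 Thm. 3.5] -/
theorem exists_tendsto_kmIter_sps [ProperSpace E] (h : IsStrictPseudocontractive k T)
    (hk : k < 1) (hfix : ∃ p, T p = p) (hμ0 : 0 < μ) (hμ : μ < 1 - k) (x₀ : E) :
    ∃ q, T q = q ∧ Tendsto (kmIter T μ x₀) atTop (𝓝 q) := by
  have h1k : 0 < 1 - k := sub_pos.2 hk
  obtain ⟨p, hp⟩ := hfix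
  have hS := norm_averagedMap_sub_le_sps h h1k.le le_rfl
  have hpS : averagedMap T (1 - k) p = p := averagedMap_eq_self_of_eq hp
  obtain ⟨q, hq, hconv⟩ := exists_tendsto_kmIter hS ⟨p, hpS⟩ (div_pos hμ0 h1k)
    ((div_lt_one h1k).2 hμ) x₀
  refine ⟨q, (averagedMap_eq_self_iff h1k.ne').1 hq, ?_⟩
  rwa [kmIter_eq_kmIter_averagedMap hk]

end Theorem35

/-! ## Exercise 4.8: strict pseudocontractions are Lipschitzian -/

omit [InnerProductSpace ℝ E] in
/-- Exercise 4.8 (Osilike–Udomene 2001): a `k`-strict pseudocontraction with `0 ≤ k < 1` is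
Lipschitzian; the proof (`‖Ux - Uy‖ ≤ ‖x - y‖ + ‖Tx - Ty‖` in (7), then solving the quadratic
inequality) gives the constant `(1 + k)/(1 - k)`.
[cite: Berinde2007, Ch. 4 Exercise 4.8] -/
theorem IsStrictPseudocontractive.lipschitz {T : E → E} {k : ℝ} (h : IsStrictPseudocontractive k T)
    (hk0 : 0 ≤ k) (hk1 : k < 1) (x y : E) : ‖T x - T y‖ ≤ (1 + k) / (1 - k) * ‖x - y‖ := by
  have h1k : 0 < 1 - k := sub_pos.2 hk1
  set a := ‖T x - T y‖ with ha
  set d := ‖x - y‖ with hd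
  have ha0 : 0 ≤ a := norm_nonneg _
  have hd0 : 0 ≤ d := norm_nonneg _
  have hn : ‖(x - T x) - (y - T y)‖ ≤ d + a := by
    have e : (x - T x) - (y - T y) = (x - y) - (T x - T y) := by abel
    rw [e]; exact norm_sub_le _ _
  have hn2 : ‖(x - T x) - (y - T y)‖ ^ 2 ≤ (d + a) ^ 2 :=
    pow_le_pow_left₀ (norm_nonneg _) hn 2
  have hq : ((1 - k) * a - (1 + k) * d) * (a + d) ≤ 0 := by
    nlinarith [h x y, mul_le_mul_of_nonneg_left hn2 hk0]
  rw [div_mul_eq_mul_div, le_div_iff₀ h1k]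
  by_contra hc
  have hc' := not_le.1 hc
  nlinarith [mul_pos (by linarith : 0 < (1 - k) * a - (1 + k) * d) (by nlinarith : 0 < a + d)]

/-! ## Exercise 4.7: a continuous pseudocontraction which is not nonexpansive -/

section Exercise47

/-- The map `Tx = 1 - x^{2/3}` of Exercise 4.7. [cite: Berinde2007, Ch. 4 Exercise 4.7] -/
noncomputable def ex47Map (x : ℝ) : ℝ := 1 - x ^ ((2 : ℝ) / 3)

/-- `T` is continuous. [cite: Berinde2007, Ch. 4 Exercise 4.7] -/
theorem continuous_ex47Map : Continuous ex47Map :=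
  continuous_const.sub (Real.continuous_rpow_const (by norm_num))

/-- `T` maps `[0, 1]` into `[0, 1]`. [cite: Berinde2007, Ch. 4 Exercise 4.7] -/
theorem ex47Map_mapsTo : MapsTo ex47Map (Icc 0 1) (Icc 0 1) := by
  intro x hx
  simp only [mem_Icc, ex47Map] at hx ⊢
  have h0 : 0 ≤ x ^ ((2 : ℝ) / 3) := Real.rpow_nonneg hx.1 _
  have h1 : x ^ ((2 : ℝ) / 3) ≤ 1 := Real.rpow_le_one hx.1 hx.2 (by norm_num)
  constructor <;> linarith

/-- `T` is decreasing on `[0, 1]`, hence `⟨Tx - Ty, x - y⟩ ≤ 0 ≤ ‖x - y‖²` there: `T` is a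
pseudocontraction on `[0, 1]` (Remark 3) restricted to the interval).
[cite: Berinde2007, Ch. 4 Exercise 4.7; Ch. 1 §1.1 Remark 3 after Def. 1.14] -/
theorem ex47_inner_le ⦃x : ℝ⦄ (hx : x ∈ Icc (0 : ℝ) 1) ⦃y : ℝ⦄ (hy : y ∈ Icc (0 : ℝ) 1) :
    ⟪ex47Map x - ex47Map y, x - y⟫ ≤ ‖x - y‖ ^ 2 := by
  simp only [mem_Icc] at hx hy
  rw [Real.inner_apply]
  have hmono : ∀ {a b : ℝ}, 0 ≤ a → a ≤ b → ex47Map b ≤ ex47Map a := fun ha hab => by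
    unfold ex47Map
    linarith [Real.rpow_le_rpow ha hab (by norm_num : (0 : ℝ) ≤ 2 / 3)]
  have hprod : (ex47Map x - ex47Map y) * (x - y) ≤ 0 := by
    rcases le_total x y with hxy | hyx
    · exact mul_nonpos_of_nonneg_of_nonpos (sub_nonneg.2 (hmono hx.1 hxy)) (sub_nonpos.2 hxy)
    · exact mul_nonpos_of_nonpos_of_nonneg (sub_nonpos.2 (hmono hy.1 hyx)) (sub_nonneg.2 hyx)
  nlinarith [sq_nonneg ‖x - y‖]

/-- `T(1/8) = 3/4` (since `(1/8)^{2/3} = 1/4`) while `T 0 = 1`.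
[cite: Berinde2007, Ch. 4 Exercise 4.7] -/
theorem ex47Map_one_eighth : ex47Map (1 / 8) = 3 / 4 ∧ ex47Map 0 = 1 := by
  have h8 : (1 / 8 : ℝ) ^ ((2 : ℝ) / 3) = 1 / 4 := by
    have e : (1 / 8 : ℝ) = (1 / 2 : ℝ) ^ (3 : ℕ) := by norm_num
    have e3 : ((3 : ℕ) : ℝ) * ((2 : ℝ) / 3) = 2 := by norm_num
    rw [e, ← Real.rpow_natCast_mul (by norm_num) 3 ((2 : ℝ) / 3), e3, Real.rpow_two]
    norm_num
  refine ⟨by rw [ex47Map, h8]; norm_num, ?_⟩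
  rw [ex47Map, Real.zero_rpow (by norm_num)]
  norm_num

/-- … so `T` is not nonexpansive on `[0, 1]`: `|T(1/8) - T 0| = 1/4 > 1/8`.
[cite: Berinde2007, Ch. 4 Exercise 4.7] -/
theorem ex47_not_nonexpansive :
    ¬ ∀ x ∈ Icc (0 : ℝ) 1, ∀ y ∈ Icc (0 : ℝ) 1, ‖ex47Map x - ex47Map y‖ ≤ ‖x - y‖ := by
  intro h
  have h1 := h (1 / 8) (by simp only [mem_Icc]; norm_num) 0 (by simp only [mem_Icc]; norm_num)
  rw [ex47Map_one_eighth.1, ex47Map_one_eighth.2, Real.norm_eq_abs, Real.norm_eq_abs] at h1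
  norm_num [abs_of_neg, abs_of_pos] at h1

end Exercise47

end Literature.Analysis.Convex.StrictPseudocontractions
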